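import Mathlib
import HarnessLib

/-!
# Crux `GrenetZeon.PolySizeQPAlgebra` (stmt-ValiantsHypothesis-8064), line `vbp-slice-dealg` —
# column and row modules of a singular `2 × 2` matrix over a finite-dimensional algebra

The brick for the residual-corank-`2` case of the type-independent local Hessian bound (memo
`evidence-8064-leafhand6-g2.md`, inequality `AL(2)`): after the normal form `A(p) ≃ diag(1_k, S)` with
`S` a `2 × 2` matrix over the maximal ideal, `det S = 0`, the Hessian of `λ(det A)` at `p` has rank
`≤ k · (ℓ(Col adj S) + ℓ(Row adj S)) + 4 dim R`, and for `2 × 2` matrices `Col(adj S) ≅ Row(S)`,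
`Row(adj S) ≅ Col(S)`.  The needed input is therefore the following elementary inequality, valid over
ANY commutative algebra `R` of finite dimension over `ℂ`:

* `finrank_range_mulVecLin_add_le_of_det_eq_zero` — for `S ∈ Mat_2(R)` with `det S = 0`,
  `dim_ℂ Col(S) + dim_ℂ Row(S) ≤ 2 · dim_ℂ R`, where `Col(S)` (`Row(S)`) is the `R`-span of the columns
  (rows), i.e. the range of `v ↦ S v` (`v ↦ Sᵀ v`) on `R²`.  Proof: the twisted row module
  `J · Row(S)`, `J(x, y) = (y, -x)`, lies in the kernel of `v ↦ S v` (`det S = 0`), and rank–nullity.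

(Over a Frobenius `R` the two summands are equal, giving `dim Col(S) ≤ dim R`; the analogue
`ℓ(im adj S) ≤ ℓ(R)` for `q × q` matrices, `q ≥ 3`, is the open inequality `AL(q)` of the memo — exact
computations over `ℂ[x,y]/(x²,y³)`, `ℂ[x,y]/(x³,y³)`, `ℂ[x,y]/(x²,y⁴)`, `ℂ[x,y,z]/(x²,y²,z²)` attain it with
equality.)  HONEST FRAMING: linear algebra; no stub of the line is closed; VP ≠ VNP is not moved.

References: T. Mignon, N. Ressayre, IMRN 2004:79, §2 [MignonRessayre2004].
-/

noncomputable section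

open Matrix

-- single-conjunct layout `Summits/ValiantsHypothesis/ValiantsHypothesis`: duplicated namespace by design
set_option linter.dupNamespace false

namespace Summit.ValiantsHypothesis.ValiantsHypothesis.Theorems.GrenetZeonPolySizeQPAlgebra

variable {R : Type*} [CommRing R] [Algebra ℂ R] [Module.Finite ℂ R]

omit [Algebra ℂ R] [Module.Finite ℂ R] in
/-- For a `2 × 2` matrix `S` with `det S = 0`, the vector `J (Sᵀ v) = ((Sᵀ v)₁, -(Sᵀ v)₀)` lies in the
kernel of `S`: `S · J · Sᵀ = det S · J'`. [folklore] -/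
theorem mulVec_twist_vecMul_eq_zero (S : Matrix (Fin 2) (Fin 2) R) (hS : S.det = 0) (v : Fin 2 → R) :
    S.mulVec ![(Sᵀ.mulVec v) 1, -((Sᵀ.mulVec v) 0)] = 0 := by
  rw [Matrix.det_fin_two] at hS
  ext i
  fin_cases i
  · simp [Matrix.mulVec, dotProduct, Fin.sum_univ_two, Matrix.transpose_apply]
    linear_combination (v 1) * hS
  · simp [Matrix.mulVec, dotProduct, Fin.sum_univ_two, Matrix.transpose_apply]
    linear_combination (-(v 0)) * hS

/-- **`AL(2)`: column plus row module of a singular `2 × 2` matrix.**  For `S ∈ Mat_2(R)` with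
`det S = 0` over a commutative algebra `R` of finite dimension over `ℂ`:
`dim_ℂ range(v ↦ S v) + dim_ℂ range(v ↦ Sᵀ v) ≤ 2 · dim_ℂ R`. [folklore] -/
theorem finrank_range_mulVecLin_add_le_of_det_eq_zero (S : Matrix (Fin 2) (Fin 2) R) (hS : S.det = 0) :
    Module.finrank ℂ (LinearMap.range (S.mulVecLin.restrictScalars ℂ)) +
      Module.finrank ℂ (LinearMap.range (Sᵀ.mulVecLin.restrictScalars ℂ)) ≤
        2 * Module.finrank ℂ R := by
  -- the twist `J (x₀, x₁) = (x₁, -x₀)` as a `ℂ`-linear map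
  set J : (Fin 2 → R) →ₗ[ℂ] (Fin 2 → R) :=
    { toFun := fun x => ![x 1, -(x 0)]
      map_add' := fun x y => by
        ext i; fin_cases i <;> simp [add_comm]
      map_smul' := fun c x => by
        ext i; fin_cases i <;> simp } with hJ
  have hJinj : Function.Injective J := by
    intro x y hxy
    have h0 := congr_fun hxy 0
    have h1 := congr_fun hxy 1
    simp only [hJ, LinearMap.coe_mk, AddHom.coe_mk, Matrix.cons_val_zero, Matrix.cons_val_one,
      neg_inj] at h0 h1
    ext i; fin_cases i
    · exact h1
    · exact h0
  -- `J (range Sᵀ) ≤ ker S`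
  have hle : (LinearMap.range (Sᵀ.mulVecLin.restrictScalars ℂ)).map J ≤
      LinearMap.ker (S.mulVecLin.restrictScalars ℂ) := by
    rintro _ ⟨y, ⟨v, rfl⟩, rfl⟩
    rw [LinearMap.mem_ker]
    exact mulVec_twist_vecMul_eq_zero S hS v
  have h1 : Module.finrank ℂ (LinearMap.range (Sᵀ.mulVecLin.restrictScalars ℂ)) ≤
      Module.finrank ℂ (LinearMap.ker (S.mulVecLin.restrictScalars ℂ)) := by
    rw [(Submodule.equivMapOfInjective J hJinj
      (LinearMap.range (Sᵀ.mulVecLin.restrictScalars ℂ))).finrank_eq]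
    exact Submodule.finrank_mono hle
  have h2 := LinearMap.finrank_range_add_finrank_ker (S.mulVecLin.restrictScalars ℂ)
  have h3 : Module.finrank ℂ (Fin 2 → R) = 2 * Module.finrank ℂ R := by
    rw [Module.finrank_pi_fintype, Fin.sum_univ_two]; ring
  omega

end Summit.ValiantsHypothesis.ValiantsHypothesis.Theorems.GrenetZeonPolySizeQPAlgebra

end
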